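import Mathlib
import HarnessLib
import Summits.Ventures.LatticeQCDFlow.Exactness.SphereLuscherSeriesConstants
import Summits.Ventures.LatticeQCDFlow.Exactness.SphereNLOFlowGenerator

/-!
# Lüscher's operator `𝓛_t = −Σ∂̃² + tΣ⟨∂̃S, ∂̃·⟩` on the lattice of site spheres is symmetric and nonnegative in `L²(e^{−tS}π̄)` and its range is orthogonal to the constants — at EVERY flow time `t` (the tilted Green identity)

HONEST FRAMING: exact (Metropolis-corrected) sampling algorithms for lattice gauge theory;
figures of merit are autocorrelation/cost numbers at stated couplings and volumes; no
continuum-physics claim.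

Venture `LatticeQCDFlow` (cell pub-lqcd), topic `Exactness`; FANOUT row 7 (`s0-cpn-null`: the S0-D1
rung — 2D CP⁹, Lüscher's LO trivializing map inside HMC, Engel–Schaefer 2011).  NEW WORK of the cell
over the tree's `Exactness/SphereLatticeGreen.lean` (GEN-8: the polarised Green identity
`∫ G·(−Σ∂̃²F) = Σ∫⟪∂̃G, ∂̃F⟫` under `⊗_Λ σ`, continuity of `∂̃F`, `∂̃²F` on `Ω`),
`Exactness/SphereLuscherSeriesConstants.lean` (its `π̄`-form `integral_mul_neg_luscher_uniform`),
`Exactness/SphereNLOFlowGenerator.lean` (`differentiableAt_section_comp_normalize`) and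
`Exactness/SphereNLOFlowTerms.lean` (`contDiff_comp_update`); nothing is cited as a fact.  Printed counterpart, NAMED ONLY: M. Lüscher,
Commun. Math. Phys. 293 (2010) 899, §4.2 eqs. (4.5)–(4.8): the trivializing flow action solves
`𝓛_t S̃_t = S + Ċ_t` with `𝓛_t = Σ{−∂ᵃ∂ᵃ + t(∂ᵃS)∂ᵃ}`, "a symmetric operator with respect to the scalar
product `(φ,ψ)_t = ∫D[U] e^{−tS}φψ`", `(φ, 𝓛_tφ)_t = Σ‖∂φ‖²_t ≥ 0`, whose only zero modes are the
constants.  Everything the tree had so far about the sphere models was at `t = 0` (`𝓛₀ = −Σ∂̃²` under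
`π̄`: GEN-8 Green / kernel / gap, GEN-10 spectrum) or inside the formal recursion; THIS FILE is the
first statement at flow time `t ≠ 0`: symmetry, the energy identity and the orthogonality of the
range to the constants for `𝓛_t` in `L²(e^{−tS}π̄)`, for every real `t` and every `C¹` action `S`
on the lattice of site spheres `Ω = S(E)^Λ` (general finite-dimensional `E`); the null space is the
sequel's.

## Content

* §1 CALCULUS OF `∂̃`: **`siteGrad_comp`** (chain rule `∂̃_n(g∘F) = g′(F)·∂̃_nF`), `siteGrad_mul`
  (Leibniz), and on `Ω`: `siteGrad_comp_sphere`, `siteGrad_mul_sphere`, **`siteGrad_exp_neg_mul`**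
  (`∂̃_n e^{−tS} = −t e^{−tS}∂̃_nS`), `siteGrad_pow_succ` (`∂̃_n S^{j+1} = (j+1)S^j ∂̃_nS`).
* §2 `sphereLuscherL S t F = −Σ_n∂̃_n·∂̃_nF + tΣ_n⟪∂̃_nS, ∂̃_nF⟫` (def) and the TILTED GREEN IDENTITY
  **`integral_exp_mul_mul_neg_luscher`**:
  `∫ e^{−tS}G·(−Σ∂̃²F)dπ̄ = Σ_n∫e^{−tS}⟪∂̃_nG, ∂̃_nF⟫dπ̄ − t·Σ_n∫e^{−tS}G⟪∂̃_nS, ∂̃_nF⟫dπ̄`;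
  hence **`integral_exp_mul_mul_sphereLuscherL`** (`∫e^{−tS}G·𝓛_tF dπ̄ = Σ_n∫e^{−tS}⟪∂̃_nG, ∂̃_nF⟫dπ̄`:
  Lüscher's (4.7)–(4.8) for the site spheres), `integral_exp_mul_mul_sphereLuscherL_comm` (SYMMETRY),
  `integral_exp_mul_self_sphereLuscherL` (ENERGY: `= Σ_n∫e^{−tS}‖∂̃_nF‖²`), `…_nonneg`,
  **`integral_exp_mul_sphereLuscherL_eq_zero`** (`∫e^{−tS}𝓛_tF dπ̄ = 0`: the range is orthogonal to the
  constants in `L²(e^{−tS}π̄)` — the solvability condition at finite `t`).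
* §3 is the sequel `Exactness/SphereLuscherFiniteTimeUniqueness.lean` (null space of `𝓛_t` = the
  constants on `Ω`, uniqueness of the finite-`t` flow action up to constants, the forced constant
  `C·∫e^{−tS}dπ̄ = −∫R e^{−tS}dπ̄`), and `Exactness/SphereLuscherNormalization.lean` turns
  `integral_exp_mul_sphereLuscherL_eq_zero` into Lüscher's normalisation identity
  `Ċ_t·∫e^{−tS}dπ̄ = −∫S e^{−tS}dπ̄` to all orders in `t` for every `C²` Lüscher series.

NOT CLAIMED: existence of solutions of `𝓛_tF = S + C` at `t ≠ 0` (the spectral gap of `𝓛_t` /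
Lüscher's App. E), anything about the flow `Φ_t` itself or its Jacobian, convergence of the series,
anything about autocorrelations or the rung's numbers.
-/

noncomputable section

namespace Summit.Ventures.LatticeQCDFlow.Exactness

open Function Set Metric MeasureTheory NormedSpace InnerProductSpace
open scoped RealInnerProductSpace

variable {Λ : Type*} {E : Type*} [NormedAddCommGroup E] [InnerProductSpace ℝ E]
  [FiniteDimensional ℝ E]

/-! ## §1 Chain and Leibniz rules for the natural site gradient -/

section Calculus

variable [DecidableEq Λ]

/-- The derivative of `s ↦ e^{−ts}`: `−t e^{−ts}`. -/
theorem hasDerivAt_exp_neg_mul (t s₀ : ℝ) :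
    HasDerivAt (fun s : ℝ => Real.exp (-(t * s))) (-(t * Real.exp (-(t * s₀)))) s₀ := by
  have h : HasDerivAt (fun s : ℝ => Real.exp (-(t * s))) (Real.exp (-(t * s₀)) * -(t * 1)) s₀ :=
    (((hasDerivAt_id' s₀).const_mul t).neg).exp
  exact h.congr_deriv (by ring)

/-- **Chain rule for `∂̃_n`**: for a `C¹` site section and `g` differentiable at its value,
`∂̃_n (g ∘ F)(x) = g′(F(x̂)) · ∂̃_n F(x)` (`x̂ = x` with `x_n` normalised). -/
theorem siteGrad_comp {F : (Λ → E) → ℝ} {g : ℝ → ℝ} {g' : ℝ} {x : Λ → E} {n : Λ} (hx : x n ≠ 0)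
    (hF : ContDiff ℝ 1 (fun y => F (update x n y)))
    (hg : HasDerivAt g g' (F (update x n (normalize (x n))))) :
    siteGrad n (fun z => g (F z)) x = g' • siteGrad n F x := by
  have hφ := (differentiableAt_section_comp_normalize hx hF).hasFDerivAt
  have h := (hg.hasFDerivAt.comp (x n) hφ).fderiv
  unfold siteGrad gradient
  rw [show (fun y : E => g (F (update x n (normalize y)))) =
      g ∘ fun y : E => F (update x n (normalize y)) from rfl, h, ← map_smul]
  congr 1
  ext v
  rw [ContinuousLinearMap.comp_apply, ContinuousLinearMap.toSpanSingleton_apply, smul_eq_mul,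
    mul_comm]
  rfl

/-- **Leibniz rule for `∂̃_n`**: `∂̃_n (G·H)(x) = G(x̂)·∂̃_n H(x) + H(x̂)·∂̃_n G(x)`. -/
theorem siteGrad_mul {G H : (Λ → E) → ℝ} {x : Λ → E} {n : Λ} (hx : x n ≠ 0)
    (hG : ContDiff ℝ 1 (fun y => G (update x n y))) (hH : ContDiff ℝ 1 (fun y => H (update x n y))) :
    siteGrad n (fun z => G z * H z) x =
      G (update x n (normalize (x n))) • siteGrad n H x +
        H (update x n (normalize (x n))) • siteGrad n G x := by
  unfold siteGrad gradient
  rw [fderiv_fun_mul (differentiableAt_section_comp_normalize hx hG)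
    (differentiableAt_section_comp_normalize hx hH), map_add, map_smul, map_smul]

omit [FiniteDimensional ℝ E] in
/-- On `Ω`, normalising a site and writing it back changes nothing. -/
theorem update_normalize_sphereConfig (ω : Λ → sphere (0 : E) 1) (n : Λ) :
    update (fun m => (ω m : E)) n (normalize ((fun m => (ω m : E)) n)) = fun m => (ω m : E) := by
  rw [normalize_eq_self_of_norm_eq_one (norm_eq_of_mem_sphere (ω n)), update_eq_self]

variable [Fintype Λ]

/-- **Chain rule on `Ω`**: `∂̃_n (g ∘ F)(ω) = g′(F(ω)) · ∂̃_n F(ω)` for `F ∈ C¹`. -/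
theorem siteGrad_comp_sphere {F : (Λ → E) → ℝ} (hF : ContDiff ℝ 1 F) {g : ℝ → ℝ} {g' : ℝ}
    (ω : Λ → sphere (0 : E) 1) (n : Λ) (hg : HasDerivAt g g' (F (fun m => (ω m : E)))) :
    siteGrad n (fun z => g (F z)) (fun m => (ω m : E)) = g' • siteGrad n F (fun m => (ω m : E)) :=
  siteGrad_comp (x := fun m => (ω m : E)) (sphereConfig_ne_zero ω n) (contDiff_comp_update hF _ n)
    (by rwa [update_normalize_sphereConfig])

/-- **Leibniz rule on `Ω`**: `∂̃_n (G·H)(ω) = G(ω)·∂̃_n H(ω) + H(ω)·∂̃_n G(ω)` for `G, H ∈ C¹`. -/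
theorem siteGrad_mul_sphere {G H : (Λ → E) → ℝ} (hG : ContDiff ℝ 1 G) (hH : ContDiff ℝ 1 H)
    (ω : Λ → sphere (0 : E) 1) (n : Λ) :
    siteGrad n (fun z => G z * H z) (fun m => (ω m : E)) =
      G (fun m => (ω m : E)) • siteGrad n H (fun m => (ω m : E)) +
        H (fun m => (ω m : E)) • siteGrad n G (fun m => (ω m : E)) := by
  rw [siteGrad_mul (x := fun m => (ω m : E)) (sphereConfig_ne_zero ω n)
    (contDiff_comp_update hG _ n) (contDiff_comp_update hH _ n), update_normalize_sphereConfig]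

/-- **`∂̃_n e^{−tS} = −t e^{−tS} ∂̃_n S`** on `Ω` (`S ∈ C¹`). -/
theorem siteGrad_exp_neg_mul {S : (Λ → E) → ℝ} (hS : ContDiff ℝ 1 S) (t : ℝ)
    (ω : Λ → sphere (0 : E) 1) (n : Λ) :
    siteGrad n (fun z => Real.exp (-(t * S z))) (fun m => (ω m : E)) =
      (-(t * Real.exp (-(t * S (fun m => (ω m : E)))))) • siteGrad n S (fun m => (ω m : E)) :=
  siteGrad_comp_sphere hS ω n (hasDerivAt_exp_neg_mul t _)

/-- **`∂̃_n S^{j+1} = (j+1) S^j ∂̃_n S`** on `Ω` (`S ∈ C¹`). -/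
theorem siteGrad_pow_succ {S : (Λ → E) → ℝ} (hS : ContDiff ℝ 1 S) (j : ℕ)
    (ω : Λ → sphere (0 : E) 1) (n : Λ) :
    siteGrad n (fun z => S z ^ (j + 1)) (fun m => (ω m : E)) =
      (((j : ℝ) + 1) * S (fun m => (ω m : E)) ^ j) • siteGrad n S (fun m => (ω m : E)) := by
  have h := hasDerivAt_pow (j + 1) (S (fun m => (ω m : E)))
  rw [Nat.add_sub_cancel] at h
  have h' : HasDerivAt (fun s : ℝ => s ^ (j + 1)) (((j : ℝ) + 1) * S (fun m => (ω m : E)) ^ j)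
      (S (fun m => (ω m : E))) := h.congr_deriv (by push_cast; ring)
  exact siteGrad_comp_sphere hS ω n h'

omit [FiniteDimensional ℝ E] [DecidableEq Λ] in
/-- `e^{−tS}` is `C^m` for `S ∈ C^m`. -/
theorem contDiff_exp_neg_mul {S : (Λ → E) → ℝ} {m : WithTop ℕ∞} (hS : ContDiff ℝ m S) (t : ℝ) :
    ContDiff ℝ m (fun z => Real.exp (-(t * S z))) :=
  Real.contDiff_exp.comp ((contDiff_const.mul hS).neg)

end Calculus

/-! ## §2 Lüscher's operator `𝓛_t` and the tilted Green identity -/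

section Operator

variable [Fintype Λ] [DecidableEq Λ]

/-- **Lüscher's operator at flow time `t` on the lattice of site spheres**:
`𝓛_t F = −Σ_n ∂̃_n·∂̃_n F + t Σ_n ⟪∂̃_n S, ∂̃_n F⟫` (eq. (4.6) of Lüscher 2010 with E–S's natural site
derivatives; `𝓛₀ = −Σ∂̃²`).  The trivializing flow action solves `𝓛_t S̃_t = S + Ċ_t`. -/
def sphereLuscherL (S : (Λ → E) → ℝ) (t : ℝ) (F : (Λ → E) → ℝ) (x : Λ → E) : ℝ :=
  -∑ n, siteLaplacian n F x + t * ∑ n, ⟪siteGrad n S x, siteGrad n F x⟫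

/-- Unfolding lemma for `sphereLuscherL`. -/
theorem sphereLuscherL_apply (S : (Λ → E) → ℝ) (t : ℝ) (F : (Λ → E) → ℝ) (x : Λ → E) :
    sphereLuscherL S t F x = -∑ n, siteLaplacian n F x + t * ∑ n, ⟪siteGrad n S x, siteGrad n F x⟫ :=
  rfl

/-- At `t = 0` Lüscher's operator is `𝓛₀ = −Σ_n ∂̃_n·∂̃_n`. -/
theorem sphereLuscherL_zero (S F : (Λ → E) → ℝ) (x : Λ → E) :
    sphereLuscherL S 0 F x = -∑ n, siteLaplacian n F x := by
  rw [sphereLuscherL_apply, zero_mul, add_zero]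

variable [MeasurableSpace E] [BorelSpace E] [Nontrivial E]

omit [InnerProductSpace ℝ E] [FiniteDimensional ℝ E] [Fintype Λ] [DecidableEq Λ] [MeasurableSpace E]
  [BorelSpace E] [Nontrivial E] in
/-- The tilted weight `ω ↦ e^{−tS(ω)}` is continuous on `Ω` for continuous `S`. -/
theorem continuous_exp_neg_mul_sphereConfig {S : (Λ → E) → ℝ} (hS : Continuous S) (t : ℝ) :
    Continuous fun ω : Λ → sphere (0 : E) 1 => Real.exp (-(t * S (fun m => (ω m : E)))) :=
  Real.continuous_exp.comp ((continuous_const.mul (hS.comp continuous_sphereConfig)).neg)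

omit [MeasurableSpace E] [BorelSpace E] [Nontrivial E] in
/-- `ω ↦ 𝓛_t F(ω)` is continuous on `Ω` (`S ∈ C¹`, `F ∈ C²`). -/
theorem continuous_sphereLuscherL_sphereConfig {S F : (Λ → E) → ℝ} (hS : ContDiff ℝ 1 S)
    (hF : ContDiff ℝ 2 F) (t : ℝ) :
    Continuous fun ω : Λ → sphere (0 : E) 1 => sphereLuscherL S t F (fun m => (ω m : E)) :=
  ((continuous_finsetSum _ fun n _ => continuous_siteLaplacian_sphereConfig hF n).neg).add
    (continuous_const.mul (continuous_finsetSum _ fun n _ =>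
      continuous_inner_siteGrad (hF.of_le (by norm_num)) hS n n))

/-- **THE TILTED GREEN IDENTITY.**  For `S, G ∈ C¹`, `F ∈ C²` and every real `t`:
`∫ e^{−tS}G·(−Σ_n∂̃_n·∂̃_nF) dπ̄ = Σ_n∫ e^{−tS}⟪∂̃_nG, ∂̃_nF⟫ dπ̄ − t·Σ_n∫ e^{−tS}G⟪∂̃_nS, ∂̃_nF⟫ dπ̄`
(polarised Green with the weight `e^{−tS}G`, Leibniz and `∂̃e^{−tS} = −te^{−tS}∂̃S`). -/
theorem integral_exp_mul_mul_neg_luscher {S F G : (Λ → E) → ℝ} (hS : ContDiff ℝ 1 S)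
    (hF : ContDiff ℝ 2 F) (hG : ContDiff ℝ 1 G) (t : ℝ) :
    ∫ ω, Real.exp (-(t * S (fun m => ((ω : Λ → sphere (0 : E) 1) m : E)))) *
        G (fun m => (ω m : E)) * -∑ n, siteLaplacian n F (fun m => (ω m : E))
          ∂Measure.pi (fun _ : Λ => uniformSphere (volume : Measure E)) =
      ∑ n, ∫ ω, Real.exp (-(t * S (fun m => ((ω : Λ → sphere (0 : E) 1) m : E)))) *
          ⟪siteGrad n G (fun m => (ω m : E)), siteGrad n F (fun m => (ω m : E))⟫
            ∂Measure.pi (fun _ : Λ => uniformSphere (volume : Measure E)) -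
        t * ∑ n, ∫ ω, Real.exp (-(t * S (fun m => ((ω : Λ → sphere (0 : E) 1) m : E)))) *
          G (fun m => (ω m : E)) *
            ⟪siteGrad n S (fun m => (ω m : E)), siteGrad n F (fun m => (ω m : E))⟫
              ∂Measure.pi (fun _ : Λ => uniformSphere (volume : Measure E)) := by
  set μ : Measure (sphere (0 : E) 1) := uniformSphere (volume : Measure E) with hμ
  have hW : ContDiff ℝ 1 (fun z => Real.exp (-(t * S z))) := contDiff_exp_neg_mul hS t
  have hWG : ContDiff ℝ 1 (fun z => Real.exp (-(t * S z)) * G z) := hW.mul hG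
  have hgreen := integral_mul_neg_luscher_uniform (Λ := Λ) hF hWG
  -- Leibniz + chain rule on Ω, paired with `∂̃_n F`
  have hpt : ∀ (n : Λ) (ω : Λ → sphere (0 : E) 1),
      ⟪siteGrad n (fun z => Real.exp (-(t * S z)) * G z) (fun m => (ω m : E)),
          siteGrad n F (fun m => (ω m : E))⟫ =
        Real.exp (-(t * S (fun m => (ω m : E)))) *
            ⟪siteGrad n G (fun m => (ω m : E)), siteGrad n F (fun m => (ω m : E))⟫ -
          t * (Real.exp (-(t * S (fun m => (ω m : E)))) * G (fun m => (ω m : E)) *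
            ⟪siteGrad n S (fun m => (ω m : E)), siteGrad n F (fun m => (ω m : E))⟫) := by
    intro n ω
    rw [siteGrad_mul_sphere hW hG ω n, siteGrad_exp_neg_mul hS t ω n, inner_add_left,
      real_inner_smul_left, real_inner_smul_left, real_inner_smul_left]
    ring
  simp_rw [hpt] at hgreen
  have hSc : Continuous S := hS.continuous
  have hi1 : ∀ n, Integrable (fun ω : Λ → sphere (0 : E) 1 =>
      Real.exp (-(t * S (fun m => (ω m : E)))) *
        ⟪siteGrad n G (fun m => (ω m : E)), siteGrad n F (fun m => (ω m : E))⟫)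
          (Measure.pi fun _ : Λ => μ) := fun n =>
    integrable_pi_of_continuous μ ((continuous_exp_neg_mul_sphereConfig hSc t).mul
      (continuous_inner_siteGrad (hF.of_le (by norm_num)) hG n n))
  have hi2 : ∀ n, Integrable (fun ω : Λ → sphere (0 : E) 1 =>
      t * (Real.exp (-(t * S (fun m => (ω m : E)))) * G (fun m => (ω m : E)) *
        ⟪siteGrad n S (fun m => (ω m : E)), siteGrad n F (fun m => (ω m : E))⟫))
          (Measure.pi fun _ : Λ => μ) := fun n =>
    (integrable_pi_of_continuous μ (((continuous_exp_neg_mul_sphereConfig hSc t).mul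
      (hG.continuous.comp continuous_sphereConfig)).mul
        (continuous_inner_siteGrad (hF.of_le (by norm_num)) hS n n))).const_mul t
  rw [hgreen, Finset.mul_sum, ← Finset.sum_sub_distrib]
  refine Finset.sum_congr rfl fun n _ => ?_
  rw [← integral_const_mul, ← integral_sub (hi1 n) (hi2 n)]

/-- **`𝓛_t` IS SYMMETRIC AND NONNEGATIVE IN `L²(e^{−tS}π̄)`** (Lüscher's (4.7)–(4.8) for the site
spheres): `∫ e^{−tS}G·𝓛_tF dπ̄ = Σ_n∫ e^{−tS}⟪∂̃_nG, ∂̃_nF⟫ dπ̄` for `S, G ∈ C¹`, `F ∈ C²`, every `t`. -/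
theorem integral_exp_mul_mul_sphereLuscherL {S F G : (Λ → E) → ℝ} (hS : ContDiff ℝ 1 S)
    (hF : ContDiff ℝ 2 F) (hG : ContDiff ℝ 1 G) (t : ℝ) :
    ∫ ω, Real.exp (-(t * S (fun m => ((ω : Λ → sphere (0 : E) 1) m : E)))) *
        G (fun m => (ω m : E)) * sphereLuscherL S t F (fun m => (ω m : E))
          ∂Measure.pi (fun _ : Λ => uniformSphere (volume : Measure E)) =
      ∑ n, ∫ ω, Real.exp (-(t * S (fun m => ((ω : Λ → sphere (0 : E) 1) m : E)))) *
          ⟪siteGrad n G (fun m => (ω m : E)), siteGrad n F (fun m => (ω m : E))⟫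
            ∂Measure.pi (fun _ : Λ => uniformSphere (volume : Measure E)) := by
  set μ : Measure (sphere (0 : E) 1) := uniformSphere (volume : Measure E) with hμ
  have hSc : Continuous S := hS.continuous
  have hcW := continuous_exp_neg_mul_sphereConfig (Λ := Λ) hSc t
  have hcG : Continuous fun ω : Λ → sphere (0 : E) 1 => G (fun m => (ω m : E)) :=
    hG.continuous.comp continuous_sphereConfig
  have hiA : Integrable (fun ω : Λ → sphere (0 : E) 1 =>
      Real.exp (-(t * S (fun m => (ω m : E)))) * G (fun m => (ω m : E)) *
        -∑ n, siteLaplacian n F (fun m => (ω m : E))) (Measure.pi fun _ : Λ => μ) :=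
    integrable_pi_of_continuous μ ((hcW.mul hcG).mul
      (continuous_finsetSum _ fun n _ => continuous_siteLaplacian_sphereConfig hF n).neg)
  have hiB : Integrable (fun ω : Λ → sphere (0 : E) 1 =>
      Real.exp (-(t * S (fun m => (ω m : E)))) * G (fun m => (ω m : E)) *
        (t * ∑ n, ⟪siteGrad n S (fun m => (ω m : E)), siteGrad n F (fun m => (ω m : E))⟫))
          (Measure.pi fun _ : Λ => μ) :=
    integrable_pi_of_continuous μ ((hcW.mul hcG).mul (continuous_const.mul
      (continuous_finsetSum _ fun n _ => continuous_inner_siteGrad (hF.of_le (by norm_num)) hS n n)))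
  have hiC : ∀ n, Integrable (fun ω : Λ → sphere (0 : E) 1 =>
      Real.exp (-(t * S (fun m => (ω m : E)))) * G (fun m => (ω m : E)) *
        ⟪siteGrad n S (fun m => (ω m : E)), siteGrad n F (fun m => (ω m : E))⟫)
          (Measure.pi fun _ : Λ => μ) := fun n =>
    integrable_pi_of_continuous μ ((hcW.mul hcG).mul
      (continuous_inner_siteGrad (hF.of_le (by norm_num)) hS n n))
  have hsplit : ∀ ω : Λ → sphere (0 : E) 1,
      Real.exp (-(t * S (fun m => (ω m : E)))) * G (fun m => (ω m : E)) *
          sphereLuscherL S t F (fun m => (ω m : E)) =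
        Real.exp (-(t * S (fun m => (ω m : E)))) * G (fun m => (ω m : E)) *
            -∑ n, siteLaplacian n F (fun m => (ω m : E)) +
          Real.exp (-(t * S (fun m => (ω m : E)))) * G (fun m => (ω m : E)) *
            (t * ∑ n, ⟪siteGrad n S (fun m => (ω m : E)), siteGrad n F (fun m => (ω m : E))⟫) :=
    fun ω => by rw [sphereLuscherL_apply, mul_add]
  simp_rw [hsplit]
  rw [integral_add hiA hiB, integral_exp_mul_mul_neg_luscher hS hF hG t]
  have hB : ∫ ω, Real.exp (-(t * S (fun m => ((ω : Λ → sphere (0 : E) 1) m : E)))) *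
        G (fun m => (ω m : E)) *
          (t * ∑ n, ⟪siteGrad n S (fun m => (ω m : E)), siteGrad n F (fun m => (ω m : E))⟫)
            ∂Measure.pi (fun _ : Λ => μ) =
      t * ∑ n, ∫ ω, Real.exp (-(t * S (fun m => ((ω : Λ → sphere (0 : E) 1) m : E)))) *
          G (fun m => (ω m : E)) *
            ⟪siteGrad n S (fun m => (ω m : E)), siteGrad n F (fun m => (ω m : E))⟫
              ∂Measure.pi (fun _ : Λ => μ) := by
    rw [← integral_finsetSum _ fun n _ => hiC n, ← integral_const_mul]
    refine integral_congr_ae (ae_of_all _ fun ω => ?_)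
    simp only
    rw [Finset.mul_sum, Finset.mul_sum, Finset.mul_sum]
    exact Finset.sum_congr rfl fun n _ => by ring
  rw [hB, sub_add_cancel]

/-- **Symmetry**: `∫ e^{−tS}G·𝓛_tF dπ̄ = ∫ e^{−tS}F·𝓛_tG dπ̄` for `F, G ∈ C²`. -/
theorem integral_exp_mul_mul_sphereLuscherL_comm {S F G : (Λ → E) → ℝ} (hS : ContDiff ℝ 1 S)
    (hF : ContDiff ℝ 2 F) (hG : ContDiff ℝ 2 G) (t : ℝ) :
    ∫ ω, Real.exp (-(t * S (fun m => ((ω : Λ → sphere (0 : E) 1) m : E)))) *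
        G (fun m => (ω m : E)) * sphereLuscherL S t F (fun m => (ω m : E))
          ∂Measure.pi (fun _ : Λ => uniformSphere (volume : Measure E)) =
      ∫ ω, Real.exp (-(t * S (fun m => ((ω : Λ → sphere (0 : E) 1) m : E)))) *
        F (fun m => (ω m : E)) * sphereLuscherL S t G (fun m => (ω m : E))
          ∂Measure.pi (fun _ : Λ => uniformSphere (volume : Measure E)) := by
  rw [integral_exp_mul_mul_sphereLuscherL hS hF (hG.of_le (by norm_num)) t,
    integral_exp_mul_mul_sphereLuscherL hS hG (hF.of_le (by norm_num)) t]
  simp_rw [real_inner_comm (siteGrad _ F _)]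

/-- **Energy identity**: `∫ e^{−tS}F·𝓛_tF dπ̄ = Σ_n∫ e^{−tS}‖∂̃_nF‖² dπ̄` (`F ∈ C²`). -/
theorem integral_exp_mul_self_sphereLuscherL {S F : (Λ → E) → ℝ} (hS : ContDiff ℝ 1 S)
    (hF : ContDiff ℝ 2 F) (t : ℝ) :
    ∫ ω, Real.exp (-(t * S (fun m => ((ω : Λ → sphere (0 : E) 1) m : E)))) *
        F (fun m => (ω m : E)) * sphereLuscherL S t F (fun m => (ω m : E))
          ∂Measure.pi (fun _ : Λ => uniformSphere (volume : Measure E)) =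
      ∑ n, ∫ ω, Real.exp (-(t * S (fun m => ((ω : Λ → sphere (0 : E) 1) m : E)))) *
          ‖siteGrad n F (fun m => (ω m : E))‖ ^ 2
            ∂Measure.pi (fun _ : Λ => uniformSphere (volume : Measure E)) := by
  rw [integral_exp_mul_mul_sphereLuscherL hS hF (hF.of_le (by norm_num)) t]
  simp_rw [real_inner_self_eq_norm_sq]

/-- **`𝓛_t ≥ 0` in `L²(e^{−tS}π̄)`**: `0 ≤ ∫ e^{−tS}F·𝓛_tF dπ̄`. -/
theorem integral_exp_mul_self_sphereLuscherL_nonneg {S F : (Λ → E) → ℝ} (hS : ContDiff ℝ 1 S)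
    (hF : ContDiff ℝ 2 F) (t : ℝ) :
    0 ≤ ∫ ω, Real.exp (-(t * S (fun m => ((ω : Λ → sphere (0 : E) 1) m : E)))) *
        F (fun m => (ω m : E)) * sphereLuscherL S t F (fun m => (ω m : E))
          ∂Measure.pi (fun _ : Λ => uniformSphere (volume : Measure E)) := by
  rw [integral_exp_mul_self_sphereLuscherL hS hF t]
  exact Finset.sum_nonneg fun n _ => integral_nonneg fun ω =>
    mul_nonneg (Real.exp_pos _).le (sq_nonneg _)

/-- **THE RANGE OF `𝓛_t` IS ORTHOGONAL TO THE CONSTANTS IN `L²(e^{−tS}π̄)`** — the solvability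
condition at finite flow time: `∫ e^{−tS}·𝓛_tF dπ̄ = 0` for `S ∈ C¹`, `F ∈ C²`, every real `t`. -/
theorem integral_exp_mul_sphereLuscherL_eq_zero {S F : (Λ → E) → ℝ} (hS : ContDiff ℝ 1 S)
    (hF : ContDiff ℝ 2 F) (t : ℝ) :
    ∫ ω, Real.exp (-(t * S (fun m => ((ω : Λ → sphere (0 : E) 1) m : E)))) *
        sphereLuscherL S t F (fun m => (ω m : E))
          ∂Measure.pi (fun _ : Λ => uniformSphere (volume : Measure E)) = 0 := by
  have h := integral_exp_mul_mul_sphereLuscherL hS hF (G := fun _ => (1 : ℝ)) contDiff_const t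
  have h0 : ∀ (n : Λ) (x : Λ → E), siteGrad n (fun _ : Λ → E => (1 : ℝ)) x = 0 := fun n x => by
    rw [siteGrad, gradient, fderiv_const_apply, map_zero]
  simpa [h0] using h

end Operator

end Summit.Ventures.LatticeQCDFlow.Exactness

end
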